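import Literature.Analysis.SpecialFunctions.GegenbauerGenerating
import HarnessLib

/-!
# Gegenbauer's connection formula `C^λ_n = Σ_k α_{n,k} C^μ_{n-2k}` (Andrews–Askey–Roy Thm. 7.1.4')

For `μ > 0` and any real `λ`,
`C^λ_n(t) = Σ_{k ≤ n/2} [(λ)_{n-k} (λ-μ)_k (n + μ - 2k)] / [(μ+1)_{n-k} k! μ] · C^μ_{n-2k}(t)`
(AAR (7.1.9)); for `λ ≥ μ` all coefficients are nonnegative — the classical input (Gegenbauer
1874, Askey) behind Schoenberg-type positivity transfer from the zonal parameter `μ = (n-2)/2`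
to every `λ ≥ μ`. AAR derive it from the Jacobi connection formula (Thm. 7.1.3, hypergeometric
manipulations) or by differentiating the Fourier form for `μ = 1, 2, …` and extending in `μ`
as a rational identity; a direct coefficient comparison is a terminating very-well-poised sum
(Dougall). We avoid all of this: **both sides satisfy the `λ`-three-term recurrence with the
same initial values**, and verifying the recurrence for the right-hand side needs only the
`μ`-recurrence and a rational identity between four neighbouring coefficients (`field_simp; ring`).

Everything is in the bivariate homogeneous form of `GegenbauerBivariate` (`P^λ_J(σ, π)`,
`ρ^J C^λ_J(t) = P^λ_J(2tρ, ρ²)`), over an arbitrary commutative `ℝ`-algebra: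

* `gegenbauerE mu k σ π` — the **shifted `ℤ`-indexed family** `E_k = P^μ_{k-1}` (`k ≥ 1`),
  `E_k = 0` (`k ≤ 0`); the point of the shift is that the recurrence
  `k E_{k+1} = (k-1+μ) σ E_k - (k-2+2μ) π E_{k-1}` then holds for **all** `k ∈ ℤ`
  (`gegenbauerE_rec`), with no boundary cases;
* `gegenbauerConn lam mu i m = a^{λ-μ}_i a^λ_m (μ+m-i) / (a^μ_m (μ+m))` — for `m = i + d` this is
  AAR's coefficient of `C^μ_d` in `C^λ_{2i+d}` (`a_k(ν) = (ν)_k/k!`);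
* `gegenbauerConnSum lam mu J σ π = Σ_{(i,m) ∈ AD J} ω(i,m) π^i E_{m-i+1}` and
  `gegenbauerConnSum_rec` (it satisfies the `λ`-recurrence), whence
* `gegenbauerHom_eq_connSum : P^λ_J = Σ_{(i,m) ∈ AD J} ω(i,m) π^i E_{m-i+1}` — **the connection
  formula** — and `gegenbauerConn_nonneg` (`ω ≥ 0` for `λ ≥ μ > 0`, `i ≤ m`).

## References

* G. E. Andrews, R. Askey, R. Roy, *Special Functions*, CUP 1999, Theorem 7.1.4' = (7.1.9),
  (7.1.11). [AndrewsAskeyRoy1999]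
-/

noncomputable section

open Finset
open scoped Nat

namespace Literature.Analysis.SpecialFunctions

variable {A : Type*} [CommRing A] [Algebra ℝ A]

/-- Solved form of the coefficient recurrence: `a_{k+1} = a_k (λ + k)/(k+1)`. [folklore] -/
theorem gegenbauerA_succ (lam : ℝ) (k : ℕ) :
    gegenbauerA lam (k + 1) = gegenbauerA lam k * (lam + k) / (k + 1) := by
  rw [eq_div_iff (by positivity), gegenbauerA_succ_mul]

/-- The `ℤ`-indexed, shifted Gegenbauer family: `E_k = 0` for `k ≤ 0`, `E_{d+1} = P^μ_d`.
[cite: AndrewsAskeyRoy1999, (6.4.16) (the family it re-indexes)] -/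
def gegenbauerE (mu : ℝ) (k : ℤ) (σ π : A) : A :=
  if k ≤ 0 then 0 else gegenbauerHom mu (k.toNat - 1) σ π

/-- `E_k = 0` for `k ≤ 0`. [folklore] -/
theorem gegenbauerE_of_nonpos (mu : ℝ) {k : ℤ} (hk : k ≤ 0) (σ π : A) :
    gegenbauerE mu k σ π = 0 := by
  simp [gegenbauerE, hk]

/-- `E_{d+1} = P^μ_d`. [folklore] -/
theorem gegenbauerE_natCast_succ (mu : ℝ) (d : ℕ) (σ π : A) :
    gegenbauerE mu ((d : ℤ) + 1) σ π = gegenbauerHom mu d σ π := by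
  have h : ¬ ((d : ℤ) + 1 ≤ 0) := by omega
  simp only [gegenbauerE, h, ↓reduceIte]
  congr 1

/-- The shifted recurrence, valid for **all** `k ∈ ℤ`:
`k E_{k+1} = (k - 1 + μ) σ E_k - (k - 2 + 2μ) π E_{k-1}` (for `k ≥ 2` this is the homogenized
AAR (6.4.16); for `k ≤ 1` both sides vanish or reduce to `P_1 = μσ`).
[cite: AndrewsAskeyRoy1999, (6.4.16)] -/
theorem gegenbauerE_rec (mu : ℝ) (σ π : A) (k : ℤ) :
    (k : ℝ) • gegenbauerE mu (k + 1) σ π =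
      ((k : ℝ) - 1 + mu) • (σ * gegenbauerE mu k σ π) -
        ((k : ℝ) - 2 + 2 * mu) • (π * gegenbauerE mu (k - 1) σ π) := by
  by_cases hk : k ≤ 0
  · rcases lt_or_eq_of_le hk with hk' | rfl
    · rw [gegenbauerE_of_nonpos mu (by omega), gegenbauerE_of_nonpos mu hk,
        gegenbauerE_of_nonpos mu (by omega)]
      simp
    · rw [gegenbauerE_of_nonpos mu (show (0 : ℤ) ≤ 0 from le_rfl),
        gegenbauerE_of_nonpos mu (show (0 : ℤ) - 1 ≤ 0 by norm_num),
        show ((0 : ℤ) + 1) = ((0 : ℕ) : ℤ) + 1 by norm_num, gegenbauerE_natCast_succ]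
      simp
  · -- k ≥ 1
    have hk : 0 < k := not_le.1 hk
    obtain ⟨n, rfl⟩ := Int.eq_ofNat_of_zero_le hk.le
    rcases n with _ | n
    · simp at hk
    rcases n with _ | d
    · -- k = 1
      rw [show ((0 + 1 : ℕ) : ℤ) + 1 = ((1 : ℕ) : ℤ) + 1 by norm_num, gegenbauerE_natCast_succ,
        show ((0 + 1 : ℕ) : ℤ) = ((0 : ℕ) : ℤ) + 1 by norm_num, gegenbauerE_natCast_succ,
        gegenbauerE_of_nonpos mu (by norm_num), gegenbauerHom_one, gegenbauerHom_zero]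
      simp
    · -- k = d + 2
      rw [show ((d + 1 + 1 : ℕ) : ℤ) + 1 = ((d + 2 : ℕ) : ℤ) + 1 by push_cast; ring,
        gegenbauerE_natCast_succ,
        show ((d + 1 + 1 : ℕ) : ℤ) = ((d + 1 : ℕ) : ℤ) + 1 by push_cast; ring,
        gegenbauerE_natCast_succ,
        show ((d + 1 : ℕ) : ℤ) + 1 - 1 = ((d : ℕ) : ℤ) + 1 by push_cast; ring,
        gegenbauerE_natCast_succ]
      have h := gegenbauerHom_rec mu σ π d
      convert h using 3 <;> push_cast <;> ring

/-- `σ E_k = (k - 1 + μ)⁻¹ [k E_{k+1} + (k - 2 + 2μ) π E_{k-1}]` for all `k ∈ ℤ` (`μ > 0`;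
when the scalar `k - 1 + μ` vanishes both sides are `0`). [folklore] -/
theorem sigma_mul_gegenbauerE {mu : ℝ} (hmu : 0 < mu) (σ π : A) (k : ℤ) :
    σ * gegenbauerE mu k σ π = ((k : ℝ) - 1 + mu)⁻¹ •
      ((k : ℝ) • gegenbauerE mu (k + 1) σ π +
        ((k : ℝ) - 2 + 2 * mu) • (π * gegenbauerE mu (k - 1) σ π)) := by
  have h := gegenbauerE_rec mu σ π k
  by_cases hc : ((k : ℝ) - 1 + mu) = 0
  · have hk : k ≤ 0 := by
      by_contra hk'
      have : (1 : ℝ) ≤ k := by exact_mod_cast (show (1 : ℤ) ≤ k by omega)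
      linarith
    rw [gegenbauerE_of_nonpos mu hk, hc]
    simp
  · rw [eq_sub_iff_add_eq] at h
    rw [h, smul_smul, inv_mul_cancel₀ hc, one_smul]

/-- The connection coefficient attached to the pair `(i, m)` (`μ`-degree `d = m - i`, total
degree `J = i + m`): `ω(i, m) = a^{λ-μ}_i a^λ_m (μ + m - i) / (a^μ_m (μ + m))`; for `m = i + d`
this is AAR's `(λ-μ)_i (λ)_{J-i} (μ + J - 2i) / (i! (μ)_{J-i+1})` ((7.1.9)).
[cite: AndrewsAskeyRoy1999, Thm. 7.1.4' (7.1.9)] -/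
def gegenbauerConn (lam mu : ℝ) (i m : ℕ) : ℝ :=
  gegenbauerA (lam - mu) i * gegenbauerA lam m * (mu + m - i) / (gegenbauerA mu m * (mu + m))

/-- The candidate expansion `H_J = Σ_{(i,m) ∈ AD J} ω(i,m) π^i E_{m-i+1}`
(`E_{m-i+1} = P^μ_{m-i}` for `m ≥ i`, `= 0` otherwise). [cite: AndrewsAskeyRoy1999, (7.1.9)] -/
def gegenbauerConnSum (lam mu : ℝ) (J : ℕ) (σ π : A) : A :=
  ∑ y ∈ antidiagonal J,
    gegenbauerConn lam mu y.1 y.2 • (π ^ y.1 * gegenbauerE mu ((y.2 : ℤ) - y.1 + 1) σ π)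

/-- `a_k(μ) > 0` for `μ > 0`. [folklore] -/
theorem gegenbauerA_pos {mu : ℝ} (hmu : 0 < mu) (k : ℕ) : 0 < gegenbauerA mu k :=
  div_pos (ascPochhammer_pos k mu hmu) (by exact_mod_cast Nat.factorial_pos k)

/-- `H_0 = 1`. [folklore] -/
theorem gegenbauerConnSum_zero {lam mu : ℝ} (hmu : 0 < mu) (σ π : A) :
    gegenbauerConnSum lam mu 0 σ π = 1 := by
  rw [gegenbauerConnSum]
  simp only [Nat.antidiagonal_zero, Finset.sum_singleton]
  rw [show ((0 : ℕ) : ℤ) - ((0 : ℕ) : ℕ) + 1 = ((0 : ℕ) : ℤ) + 1 by norm_num,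
    gegenbauerE_natCast_succ, gegenbauerHom_zero]
  simp only [gegenbauerConn, gegenbauerA_zero, pow_zero, mul_one, one_mul, Nat.cast_zero,
    add_zero, sub_zero]
  rw [div_self hmu.ne', one_smul]

/-- `H_1 = λ σ`. [folklore] -/
theorem gegenbauerConnSum_one {lam mu : ℝ} (hmu : 0 < mu) (σ π : A) :
    gegenbauerConnSum lam mu 1 σ π = lam • σ := by
  rw [gegenbauerConnSum, Nat.sum_antidiagonal_succ]
  simp only [Nat.antidiagonal_zero, Finset.sum_singleton]
  rw [show ((0 + 1 : ℕ) : ℤ) - ((0 : ℕ) : ℕ) + 1 = ((1 : ℕ) : ℤ) + 1 by norm_num,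
    gegenbauerE_natCast_succ, gegenbauerHom_one, gegenbauerE_of_nonpos mu (by norm_num)]
  simp only [zero_add, gegenbauerConn, gegenbauerA_zero, gegenbauerA_one, pow_zero, one_mul,
    smul_zero, add_zero, mul_zero, smul_smul]
  congr 1
  push_cast
  field_simp
  ring

/-- **`H` satisfies the `λ`-recurrence** `(J+2) H_{J+2} = (J+1+λ) σ H_{J+1} - (J+2λ) π H_J`:
expand `σ E_k` by the uniform `μ`-recurrence, realign the four resulting sums on the
antidiagonal, and check a rational identity between `ω(i+1,m+1)`, `ω(i,m)`, `ω(i+1,m)`,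
`ω(i,m+1)` termwise. [cite: AndrewsAskeyRoy1999, Thm. 7.1.4' (proof strategy ours)] -/
theorem gegenbauerConnSum_rec {lam mu : ℝ} (hmu : 0 < mu) (σ π : A) (J : ℕ) :
    ((J : ℝ) + 2) • gegenbauerConnSum lam mu (J + 2) σ π =
      ((J : ℝ) + 1 + lam) • (σ * gegenbauerConnSum lam mu (J + 1) σ π) -
        ((J : ℝ) + 2 * lam) • (π * gegenbauerConnSum lam mu J σ π) := by
  set ω : ℕ → ℕ → ℝ := gegenbauerConn lam mu with hω
  set E : ℤ → A := fun k => gegenbauerE mu k σ π with hE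
  set f : ℕ × ℕ → A := fun y => ω y.1 y.2 • (π ^ y.1 * E ((y.2 : ℤ) - y.1 + 1)) with hf
  have hH : ∀ n, gegenbauerConnSum lam mu n σ π = ∑ y ∈ antidiagonal n, f y := fun n => rfl
  -- (c) the left-hand side, doubly peeled
  have hc : gegenbauerConnSum lam mu (J + 2) σ π =
      f (0, J + 1 + 1) + ∑ y ∈ antidiagonal J, f (y.1 + 1, y.2 + 1) := by
    rw [hH, Nat.sum_antidiagonal_succ, Nat.sum_antidiagonal_succ']
    have h0 : f (J + 1 + 1, 0) = 0 := by
      simp only [hf, hE]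
      rw [gegenbauerE_of_nonpos mu (by push_cast; omega)]
      simp
    rw [h0, zero_add]
  -- (b) σ H_{J+1}
  set g1 : ℕ × ℕ → A := fun y =>
    (ω y.1 y.2 * ((((y.2 : ℤ) - y.1 + 1 : ℤ) : ℝ) - 1 + mu)⁻¹ * (((y.2 : ℤ) - y.1 + 1 : ℤ) : ℝ)) •
      (π ^ y.1 * E ((y.2 : ℤ) - y.1 + 1 + 1)) with hg1
  set g2 : ℕ × ℕ → A := fun y =>
    (ω y.1 y.2 * ((((y.2 : ℤ) - y.1 + 1 : ℤ) : ℝ) - 1 + mu)⁻¹ *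
      ((((y.2 : ℤ) - y.1 + 1 : ℤ) : ℝ) - 2 + 2 * mu)) •
      (π ^ y.1 * (π * E ((y.2 : ℤ) - y.1 + 1 - 1))) with hg2
  have hσf : ∀ y : ℕ × ℕ, σ * f y = g1 y + g2 y := by
    intro y
    simp only [hf, hg1, hg2, hE]
    rw [mul_smul_comm, mul_left_comm, sigma_mul_gegenbauerE hmu σ π ((y.2 : ℤ) - y.1 + 1)]
    simp only [smul_add, mul_add, mul_smul_comm, smul_smul]
    module
  have hb : σ * gegenbauerConnSum lam mu (J + 1) σ π =
      g1 (0, J + 1) + ∑ y ∈ antidiagonal J, g1 (y.1 + 1, y.2) +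
        ∑ y ∈ antidiagonal J, g2 (y.1, y.2 + 1) := by
    rw [hH, Finset.mul_sum, Finset.sum_congr rfl fun y _ => hσf y, Finset.sum_add_distrib,
      Nat.sum_antidiagonal_succ, Nat.sum_antidiagonal_succ' (f := g2)]
    have h0 : g2 (J + 1, 0) = 0 := by
      simp only [hg2, hE]
      rw [gegenbauerE_of_nonpos mu (by push_cast; omega)]
      simp
    rw [h0, zero_add]
  -- (a) π H_J
  have ha : π * gegenbauerConnSum lam mu J σ π =
      ∑ y ∈ antidiagonal J, ω y.1 y.2 • (π ^ y.1 * (π * E ((y.2 : ℤ) - y.1 + 1))) := by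
    rw [hH, Finset.mul_sum]
    refine Finset.sum_congr rfl fun y _ => ?_
    simp only [hf]
    rw [mul_smul_comm, mul_left_comm]
  -- boundary terms
  have hbd : ((J : ℝ) + 2) • f (0, J + 1 + 1) = ((J : ℝ) + 1 + lam) • g1 (0, J + 1) := by
    simp only [hf, hg1, hE]
    push_cast
    rw [show ((J : ℤ) + 1 - 0 + 1 + 1 : ℤ) = (J : ℤ) + 1 + 1 - 0 + 1 by ring, smul_smul, smul_smul]
    congr 1
    simp only [hω, gegenbauerConn, gegenbauerA_zero, one_mul, Nat.cast_zero, sub_zero,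
      gegenbauerA_succ lam (J + 1), gegenbauerA_succ mu (J + 1)]
    have hb1 := (gegenbauerA_pos hmu (J + 1)).ne'
    have h2 : mu + ((J : ℝ) + 1) ≠ 0 := by positivity
    have h3 : mu + ((J : ℝ) + 1 + 1) ≠ 0 := by positivity
    have h4 : (J : ℝ) + 1 + 1 ≠ 0 := by positivity
    have h5 : ((J : ℝ) + 1 + 1 - 1 + mu) ≠ 0 := by
      have : (0 : ℝ) < (J : ℝ) + 1 + mu := by positivity
      intro h; linarith
    push_cast
    field_simp
    ring
  -- assemble
  rw [hc, hb, ha, smul_add, smul_add, smul_add, hbd,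
    show ∀ a b d e : A, a + b + d - e = a + (b + d - e) from fun a b d e => by abel]
  congr 1
  rw [Finset.smul_sum, Finset.smul_sum, Finset.smul_sum, Finset.smul_sum, eq_sub_iff_add_eq,
    ← Finset.sum_add_distrib, ← Finset.sum_add_distrib]
  refine Finset.sum_congr rfl fun y hy => ?_
  rw [mem_antidiagonal] at hy
  obtain ⟨i, m⟩ := y
  simp only at hy ⊢
  simp only [hf, hg1, hg2, hE, smul_smul]
  push_cast
  have e1 : ((m : ℤ) + 1 - ((i : ℤ) + 1) + 1) = (m : ℤ) - i + 1 := by ring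
  have e2 : ((m : ℤ) - ((i : ℤ) + 1) + 1 + 1) = (m : ℤ) - i + 1 := by ring
  have e3 : ((m : ℤ) + 1 - i + 1 - 1) = (m : ℤ) - i + 1 := by ring
  rw [e1, e2, e3, pow_succ, mul_assoc]
  by_cases him : i ≤ m
  · obtain ⟨d, rfl⟩ := Nat.exists_eq_add_of_le him
    subst hy
    rw [← add_smul, ← add_smul]
    congr 1
    -- the scalar identity
    simp only [hω, gegenbauerConn, gegenbauerA_succ (lam - mu) i, gegenbauerA_succ lam (i + d),
      gegenbauerA_succ mu (i + d)]
    have hb0 := (gegenbauerA_pos hmu (i + d)).ne'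
    rcases d with _ | d
    · have hK : ((i + 0 : ℕ) : ℝ) - ((i : ℝ) + 1) + 1 = 0 := by push_cast; ring
      have hc2 : ((i + 0 : ℕ) : ℝ) + 1 - (i : ℝ) + 1 - 1 + mu = mu + 1 := by push_cast; ring
      rw [hK, hc2]
      push_cast
      have h1 : (i : ℝ) + 1 ≠ 0 := by positivity
      have h2 : mu + (i : ℝ) ≠ 0 := by positivity
      have h3 : mu + ((i : ℝ) + 1) ≠ 0 := by positivity
      have h4 : mu + 1 ≠ 0 := by positivity
      field_simp
      ring
    · have hc1 : ((i + (d + 1) : ℕ) : ℝ) - ((i : ℝ) + 1) + 1 - 1 + mu = d + mu := by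
        push_cast; ring
      have hc2 : ((i + (d + 1) : ℕ) : ℝ) + 1 - (i : ℝ) + 1 - 1 + mu = d + 2 + mu := by
        push_cast; ring
      rw [hc1, hc2]
      push_cast
      have h1 : (i : ℝ) + 1 ≠ 0 := by positivity
      have h2 : mu + ((i : ℝ) + ((d : ℝ) + 1)) ≠ 0 := by positivity
      have h3 : mu + ((i : ℝ) + ((d : ℝ) + 1) + 1) ≠ 0 := by positivity
      have h4 : (d : ℝ) + mu ≠ 0 := by positivity
      have h5 : (d : ℝ) + 2 + mu ≠ 0 := by positivity
      have h6 : (i : ℝ) + ((d : ℝ) + 1) + 1 ≠ 0 := by positivity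
      field_simp
      ring
  · have hle : (m : ℤ) - i + 1 ≤ 0 := by omega
    rw [gegenbauerE_of_nonpos mu hle]
    simp

/-- **Gegenbauer's connection formula** (AAR Theorem 7.1.4', (7.1.9)), bivariate form:
`P^λ_J(σ, π) = Σ_{(i,m) ∈ AD J} ω(i,m) π^i E_{m-i+1}`, i.e.
`C^λ_J = Σ_{i ≤ J/2} [(λ-μ)_i (λ)_{J-i} (μ+J-2i) / (i! (μ)_{J-i+1})] C^μ_{J-2i}` for `μ > 0`.
[cite: AndrewsAskeyRoy1999, Thm. 7.1.4' (7.1.9)] -/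
theorem gegenbauerHom_eq_connSum {lam mu : ℝ} (hmu : 0 < mu) (σ π : A) (J : ℕ) :
    gegenbauerHom lam J σ π = gegenbauerConnSum lam mu J σ π := by
  induction J using Nat.twoStepInduction with
  | zero => rw [gegenbauerHom_zero, gegenbauerConnSum_zero hmu]
  | one => rw [gegenbauerHom_one, gegenbauerConnSum_one hmu]
  | more k h0 h1 =>
    have hP := gegenbauerHom_rec lam σ π k
    have hH := gegenbauerConnSum_rec (lam := lam) hmu σ π k
    rw [← h0, ← h1] at hH
    have hc : ((k : ℝ) + 2) ≠ 0 := by positivity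
    have := congrArg (fun w => ((k : ℝ) + 2)⁻¹ • w) (hP.trans hH.symm)
    simpa only [smul_smul, inv_mul_cancel₀ hc, one_smul] using this

/-- **Nonnegativity of the connection coefficients** for `λ ≥ μ > 0` (Gegenbauer; AAR §7.1).
[cite: AndrewsAskeyRoy1999, Thm. 7.1.4' (positivity for λ ≥ μ)] -/
theorem gegenbauerConn_nonneg {lam mu : ℝ} (hmu : 0 < mu) (hlm : mu ≤ lam) {i m : ℕ}
    (him : i ≤ m) : 0 ≤ gegenbauerConn lam mu i m := by
  unfold gegenbauerConn
  have h1 : 0 ≤ gegenbauerA (lam - mu) i := gegenbauerA_nonneg (by linarith) i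
  have h2 : 0 ≤ gegenbauerA lam m := gegenbauerA_nonneg (by linarith) m
  have h3 : 0 < gegenbauerA mu m := gegenbauerA_pos hmu m
  have h4 : (i : ℝ) ≤ m := by exact_mod_cast him
  apply div_nonneg
  · apply mul_nonneg (mul_nonneg h1 h2); linarith
  · positivity

end Literature.Analysis.SpecialFunctions

end
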